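import Mathlib
import HarnessLib
import Summits.Ventures.LatticeQCDFlow.Exactness.NCMCGeneralSpaceOccupancyChainDoeblinHeatBath

/-!
# End to end, the coupling shape: the NCMC chain between two Wilson couplings with heat-bath link sweeps converges from EVERY initial gauge field, with certified error bars

HONEST FRAMING: exact (Metropolis-corrected) sampling algorithms for lattice gauge theory;
figures of merit are autocorrelation/cost numbers at stated couplings and volumes; no
continuum-physics claim.

Venture `LatticeQCDFlow` (cell pub-lqcd), topic `Exactness`; FANOUT row 13 (`eng-snf`, GEN-18).
NEW WORK of the cell, not a published result; no definition is introduced; nothing is cited as a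
fact.  ASSEMBLY of GEN-18's chain (`…OccupancyChainDoeblinHeatBath`: existential two-step certificate
⇒ every start + error bars) with row 9's torus Wilson heat-bath theorems, in the setting of GEN-17's
`NCMCGeneralSpaceOccupancyChainHeatBath.CrooksPair.ncmc_wilsonHeatBath` (THE COUPLING SHAPE of
`latflow-snf`'s `run_ncmc_chain`: prior `wilsonWeight ρ β₀`, target `wilsonWeight ρ β₁`, single-link
heat-bath scans at `β₀` / `β₁` between switches).  GEN-17: ergodic + consistent from `π_c`.  GEN-18:
from EVERY initial gauge field, for every `c ≠ ΔF` with no hypothesis on the protocol (at `c = ΔF`: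
the forward work not almost surely `c`), plus the Doeblin-quality burn-in / variance / deviation
bounds for `p̂_n` and `dF_occ`.

## Content

* §1 `wilson_heatBath_minorising` — for `wilsonWeight ρ β` (compact second-countable `G`,
  continuous `ρ`, `L ≠ 0`) and an edge list visiting every edge: an explicit `ε • ⊗Haar` (finite,
  non-zero) lies below every row of the heat-bath link sweep and dominates `wilsonWeight ρ β` in the
  sense of absolute continuity (the Gibbs density of a continuous action on a compact configuration
  space is bounded above and below — row 9's `gibbsDensity_bounds`, `heatBathSweep_minorised`).
* §2 **`CrooksPair.ncmc_wilsonHeatBath_everyStart`** — THE ENGINE BETWEEN TWO COUPLINGS, FROM EVERY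
  START: for every Crooks pair from `wilsonWeight ρ β₀` to `wilsonWeight ρ β₁`, every `c` with the
  forward work not almost surely equal to `c`, and EVERY initial state of the expanded ensemble:
  the occupancy fraction converges to `σ(c − ΔF)` and `dF_occ,n` to `ΔF` (`e^{−ΔF} = Z_{β₁}/Z_{β₀}`)
  almost surely; **`CrooksPair.ncmc_wilsonHeatBath_everyStart_of_ne`** — every `c ≠ ΔF`, no work
  hypothesis; **`CrooksPair.ncmc_wilsonHeatBath_errorBars`** — `∃ ε ∈ (0, 1]` with the burn-in bound
  `|E p̂_n − σ| ≤ 2/(ε n)` from any initial law, `Var_π p̂_n ≤ 2(1/2 + (2/ε − 1)/(1 − σ)) σ(1 − σ)/n`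
  and `P_π(|dF_occ,n − ΔF| ≥ η) ≤ that/δ_η²`.

NOT CLAIMED: the value of `ε`; the 1HB + n OR composite and the SU(N) Cabibbo–Marinari sweep (the
same assembly through `measure_le_comp` / `latSweep_minorised`; not written out); anything numerical.
-/

namespace Summit.Ventures.LatticeQCDFlow.Exactness.GeneralNCMC

open MeasureTheory ProbabilityTheory Set Filter Finset
open scoped ENNReal Topology

section Wilson

open Literature.MathematicalPhysics.QuantumFieldTheory

variable {d L N : ℕ} {G : Type*} [Group G] [TopologicalSpace G] [IsTopologicalGroup G]
  (ρ : G →* Matrix (Fin N) (Fin N) ℂ) [CompactSpace G] [MeasurableSpace G] [BorelSpace G]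
  [SecondCountableTopology G]

/-- **An explicit minorising measure of the Wilson heat-bath link sweep, dominating the weight.**
For `wilsonWeight ρ β` and an edge list visiting every edge there is a finite non-zero measure below
every row of the heat-bath link sweep with respect to which `wilsonWeight ρ β` is absolutely
continuous (namely `(m/M)^{|l|} • ⊗Haar`, `m`, `M` the extreme values of the Gibbs density). -/
theorem wilson_heatBath_minorising [NeZero L] (hρ : Continuous ρ) (β : ℝ) {l : List (Edge d L)}
    (hl : ∀ ed, ed ∈ l) :
    ∃ (mm : Measure (GaugeConfig d L G)) (_ : IsFiniteMeasure mm), mm univ ≠ 0 ∧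
      (∀ z, mm ≤ cycle (l.map (siteHeatBath (fun _ : Edge d L => haarProbability G)
        (gibbsDensity fun U : GaugeConfig d L G => β * wilsonAction ρ U))) z) ∧
      wilsonWeight (d := d) (L := L) ρ β ≪ mm := by
  have hS : Continuous fun U : GaugeConfig d L G => β * wilsonAction ρ U :=
    continuous_smul_wilsonAction ρ hρ β
  haveI : Nonempty (GaugeConfig d L G) := ⟨fun _ => 1⟩
  obtain ⟨ωa, -, hmin⟩ := isCompact_univ.exists_isMinOn Set.univ_nonempty hS.continuousOn
  obtain ⟨ωb, -, hmax⟩ := isCompact_univ.exists_isMaxOn Set.univ_nonempty hS.continuousOn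
  have hωa : ∀ U, β * wilsonAction ρ ωa ≤ β * wilsonAction ρ U :=
    fun U => (isMinOn_iff.1 hmin) U (Set.mem_univ U)
  have hωb : ∀ U, β * wilsonAction ρ U ≤ β * wilsonAction ρ ωb :=
    fun U => (isMaxOn_iff.1 hmax) U (Set.mem_univ U)
  have hm0 : ENNReal.ofReal (Real.exp (-(β * wilsonAction ρ ωb))) ≠ 0 := by
    rw [ne_eq, ENNReal.ofReal_eq_zero, not_le]; exact Real.exp_pos _
  have hp := measurable_gibbsDensity hS
  have hmp := fun ω => (gibbsDensity_bounds hωa hωb ω).1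
  have hpM := fun ω => (gibbsDensity_bounds hωa hωb ω).2
  obtain ⟨hmfin, hmu, hmin', hac⟩ := heatBath_minorising (μ := fun _ : Edge d L => haarProbability G)
    hp hm0 ENNReal.ofReal_ne_top hmp hpM hl
  refine ⟨_, hmfin, hmu, hmin', ?_⟩
  rw [wilsonWeight_eq_pi_withDensity]
  exact hac

/-- **THE ENGINE'S NCMC CHAIN BETWEEN TWO WILSON COUPLINGS CONVERGES FROM EVERY INITIAL STATE.**
Torus Wilson theory, compact second-countable `G`, continuous `ρ`, `L ≠ 0`; prior weight
`wilsonWeight ρ β₀`, target weight `wilsonWeight ρ β₁`, level samplers the single-link heat-bath scans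
at `β₀` / `β₁` over edge lists visiting every edge; ANY Crooks pair between the two weights, ANY `c`
with the forward work not almost surely equal to `c`, `e^{−ΔF} = Z_{β₁}/Z_{β₀}`: from EVERY initial
state `z`, along the chain started at `z`, the occupancy fraction converges to `σ(c − ΔF)` and
`dF_occ,n` to `ΔF` almost surely. -/
theorem CrooksPair.ncmc_wilsonHeatBath_everyStart [NeZero L] (hρ : Continuous ρ) (β₀ β₁ : ℝ)
    {l₀ l₁ : List (Edge d L)} (hl₀ : ∀ ed, ed ∈ l₀) (hl₁ : ∀ ed, ed ∈ l₁)
    {E : Type*} [MeasurableSpace E] {κF κR : Kernel (GaugeConfig d L G) E} [IsMarkovKernel κF]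
    [IsMarkovKernel κR] {s e : E → GaugeConfig d L G} {W : E → ℝ}
    (h : CrooksPair (wilsonWeight (d := d) (L := L) ρ β₀) (wilsonWeight (d := d) (L := L) ρ β₁)
      κF κR s e W) (c : ℝ)
    (hW : ((wilsonWeight (d := d) (L := L) ρ β₀).bind κF) {ε | W ε ≠ c} ≠ 0) {ΔF : ℝ}
    (hΔF : Real.exp (-ΔF) = (((wilsonWeight (d := d) (L := L) ρ β₀) univ)⁻¹ *
      (wilsonWeight (d := d) (L := L) ρ β₁) univ).toReal) :
    ∃ (_ : IsMarkovKernel (switchKernel κF κR c W s e))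
      (_ : IsMarkovKernel (levelKernel
        (cycle (l₀.map (siteHeatBath (fun _ : Edge d L => haarProbability G)
          (gibbsDensity fun U : GaugeConfig d L G => β₀ * wilsonAction ρ U))))
        (cycle (l₁.map (siteHeatBath (fun _ : Edge d L => haarProbability G)
          (gibbsDensity fun U : GaugeConfig d L G => β₁ * wilsonAction ρ U)))))),
      ∀ z : Bool × GaugeConfig d L G,
        ∀ᵐ x ∂(Kernel.trajMeasure (X := fun _ : ℕ => Bool × GaugeConfig d L G) (Measure.dirac z)
          (fun n : ℕ => (switchKernel κF κR c W s e ∘ₖ levelKernel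
            (cycle (l₀.map (siteHeatBath (fun _ : Edge d L => haarProbability G)
              (gibbsDensity fun U : GaugeConfig d L G => β₀ * wilsonAction ρ U))))
            (cycle (l₁.map (siteHeatBath (fun _ : Edge d L => haarProbability G)
              (gibbsDensity fun U : GaugeConfig d L G => β₁ * wilsonAction ρ U))))).comap
            (fun hh : (j : ↥(Finset.Iic n)) → Bool × GaugeConfig d L G =>
              hh ⟨n, Finset.mem_Iic.2 le_rfl⟩) (measurable_pi_apply _))),
        Tendsto (fun n : ℕ => (∑ i ∈ range n,
            (targetLevel (GaugeConfig d L G)).indicator (1 : Bool × GaugeConfig d L G → ℝ) (x i)) / n)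
          atTop (𝓝 (Real.sigmoid (c - ΔF))) ∧
        Tendsto (fun n : ℕ => c - Real.log
            ((∑ i ∈ range n, (targetLevel (GaugeConfig d L G)).indicator
                (1 : Bool × GaugeConfig d L G → ℝ) (x i)) / n /
              (1 - (∑ i ∈ range n, (targetLevel (GaugeConfig d L G)).indicator
                (1 : Bool × GaugeConfig d L G → ℝ) (x i)) / n)))
          atTop (𝓝 ΔF) := by
  obtain ⟨hMk₀, hfin₀, -, -, h0, -, hK₀, -⟩ := wilson_heatBathSweep_package ρ hρ β₀ hl₀
  obtain ⟨hMk₁, hfin₁, -, -, h1, -, hK₁, -⟩ := wilson_heatBathSweep_package ρ hρ β₁ hl₁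
  obtain ⟨m₀, hmfin₀, hm₀, hmin₀, hac₀⟩ := wilson_heatBath_minorising ρ hρ β₀ hl₀
  obtain ⟨m₁, hmfin₁, hm₁, hmin₁, hac₁⟩ := wilson_heatBath_minorising ρ hρ β₁ hl₁
  haveI := hMk₀
  haveI := hMk₁
  haveI := hfin₀
  haveI := hfin₁
  haveI := hmfin₀
  haveI := hmfin₁
  refine ⟨isMarkovKernel_switchKernel (κF := κF) (κR := κR) (c := c)
      h.measurable_W h.measurable_s h.measurable_e, isMarkovKernel_levelKernel _ _, fun z => ?_⟩
  exact h.ncmc_everyStart_of_exists_sq h0 h1 hK₀ hK₁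
    (h.ncmc_exists_sq_doeblin hm₀ hm₁ hmin₀ hmin₁ hac₀ hac₁ c hW) hΔF z

/-- **… for EVERY `c ≠ ΔF`, with no hypothesis on the protocol beyond the Crooks pair.** -/
theorem CrooksPair.ncmc_wilsonHeatBath_everyStart_of_ne [NeZero L] (hρ : Continuous ρ) (β₀ β₁ : ℝ)
    {l₀ l₁ : List (Edge d L)} (hl₀ : ∀ ed, ed ∈ l₀) (hl₁ : ∀ ed, ed ∈ l₁)
    {E : Type*} [MeasurableSpace E] {κF κR : Kernel (GaugeConfig d L G) E} [IsMarkovKernel κF]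
    [IsMarkovKernel κR] {s e : E → GaugeConfig d L G} {W : E → ℝ}
    (h : CrooksPair (wilsonWeight (d := d) (L := L) ρ β₀) (wilsonWeight (d := d) (L := L) ρ β₁)
      κF κR s e W) {c ΔF : ℝ}
    (hΔF : Real.exp (-ΔF) = (((wilsonWeight (d := d) (L := L) ρ β₀) univ)⁻¹ *
      (wilsonWeight (d := d) (L := L) ρ β₁) univ).toReal) (hc : c ≠ ΔF) :
    ∃ (_ : IsMarkovKernel (switchKernel κF κR c W s e))
      (_ : IsMarkovKernel (levelKernel
        (cycle (l₀.map (siteHeatBath (fun _ : Edge d L => haarProbability G)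
          (gibbsDensity fun U : GaugeConfig d L G => β₀ * wilsonAction ρ U))))
        (cycle (l₁.map (siteHeatBath (fun _ : Edge d L => haarProbability G)
          (gibbsDensity fun U : GaugeConfig d L G => β₁ * wilsonAction ρ U)))))),
      ∀ z : Bool × GaugeConfig d L G,
        ∀ᵐ x ∂(Kernel.trajMeasure (X := fun _ : ℕ => Bool × GaugeConfig d L G) (Measure.dirac z)
          (fun n : ℕ => (switchKernel κF κR c W s e ∘ₖ levelKernel
            (cycle (l₀.map (siteHeatBath (fun _ : Edge d L => haarProbability G)
              (gibbsDensity fun U : GaugeConfig d L G => β₀ * wilsonAction ρ U))))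
            (cycle (l₁.map (siteHeatBath (fun _ : Edge d L => haarProbability G)
              (gibbsDensity fun U : GaugeConfig d L G => β₁ * wilsonAction ρ U))))).comap
            (fun hh : (j : ↥(Finset.Iic n)) → Bool × GaugeConfig d L G =>
              hh ⟨n, Finset.mem_Iic.2 le_rfl⟩) (measurable_pi_apply _))),
        Tendsto (fun n : ℕ => (∑ i ∈ range n,
            (targetLevel (GaugeConfig d L G)).indicator (1 : Bool × GaugeConfig d L G → ℝ) (x i)) / n)
          atTop (𝓝 (Real.sigmoid (c - ΔF))) ∧
        Tendsto (fun n : ℕ => c - Real.log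
            ((∑ i ∈ range n, (targetLevel (GaugeConfig d L G)).indicator
                (1 : Bool × GaugeConfig d L G → ℝ) (x i)) / n /
              (1 - (∑ i ∈ range n, (targetLevel (GaugeConfig d L G)).indicator
                (1 : Bool × GaugeConfig d L G → ℝ) (x i)) / n)))
          atTop (𝓝 ΔF) := by
  obtain ⟨-, hfin₀, -, -, h0, -, -, -⟩ := wilson_heatBathSweep_package ρ hρ β₀ hl₀
  obtain ⟨-, hfin₁, -, -, -, -, -, -⟩ := wilson_heatBathSweep_package ρ hρ β₁ hl₁
  haveI := hfin₀
  haveI := hfin₁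
  exact h.ncmc_wilsonHeatBath_everyStart ρ hρ β₀ β₁ hl₀ hl₁ c
    (h.bind_work_ne_ne_zero_of_ne h0 hΔF hc) hΔF

/-- **CERTIFIED ERROR BARS FOR THE ENGINE BETWEEN TWO WILSON COUPLINGS.**  Same hypotheses: there
is an `ε ∈ (0, 1]` such that, with `σ = σ(c − ΔF)`: from ANY initial law `|E p̂_n − σ| ≤ 2/(ε n)`; in
equilibrium `Var p̂_n ≤ 2 (1/2 + (2/ε − 1)/(1 − σ)) σ(1 − σ)/n` and `P(|dF_occ,n − ΔF| ≥ η) ≤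
that/δ_η²`, `δ_η = min(σ(c − ΔF + η) − σ, σ − σ(c − ΔF − η))`. -/
theorem CrooksPair.ncmc_wilsonHeatBath_errorBars [NeZero L] (hρ : Continuous ρ) (β₀ β₁ : ℝ)
    {l₀ l₁ : List (Edge d L)} (hl₀ : ∀ ed, ed ∈ l₀) (hl₁ : ∀ ed, ed ∈ l₁)
    {E : Type*} [MeasurableSpace E] {κF κR : Kernel (GaugeConfig d L G) E} [IsMarkovKernel κF]
    [IsMarkovKernel κR] {s e : E → GaugeConfig d L G} {W : E → ℝ}
    (h : CrooksPair (wilsonWeight (d := d) (L := L) ρ β₀) (wilsonWeight (d := d) (L := L) ρ β₁)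
      κF κR s e W) (c : ℝ)
    (hW : ((wilsonWeight (d := d) (L := L) ρ β₀).bind κF) {ε | W ε ≠ c} ≠ 0) {ΔF : ℝ}
    (hΔF : Real.exp (-ΔF) = (((wilsonWeight (d := d) (L := L) ρ β₀) univ)⁻¹ *
      (wilsonWeight (d := d) (L := L) ρ β₁) univ).toReal) :
    ∃ (_ : IsMarkovKernel (switchKernel κF κR c W s e))
      (_ : IsMarkovKernel (levelKernel
        (cycle (l₀.map (siteHeatBath (fun _ : Edge d L => haarProbability G)
          (gibbsDensity fun U : GaugeConfig d L G => β₀ * wilsonAction ρ U))))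
        (cycle (l₁.map (siteHeatBath (fun _ : Edge d L => haarProbability G)
          (gibbsDensity fun U : GaugeConfig d L G => β₁ * wilsonAction ρ U))))))
      (_ : IsFiniteMeasure (wilsonWeight (d := d) (L := L) ρ β₀))
      (_ : IsFiniteMeasure (wilsonWeight (d := d) (L := L) ρ β₁)) (ε : ℝ), 0 < ε ∧ ε ≤ 1 ∧
      (∀ (μ₀ : Measure (Bool × GaugeConfig d L G)) [IsProbabilityMeasure μ₀] (n : ℕ), n ≠ 0 →
        |∫ x, (∑ i ∈ range n, (targetLevel (GaugeConfig d L G)).indicator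
              (1 : Bool × GaugeConfig d L G → ℝ) (x i)) / n
            ∂(Kernel.trajMeasure (X := fun _ : ℕ => Bool × GaugeConfig d L G) μ₀
              (fun n : ℕ => (switchKernel κF κR c W s e ∘ₖ levelKernel
                (cycle (l₀.map (siteHeatBath (fun _ : Edge d L => haarProbability G)
                  (gibbsDensity fun U : GaugeConfig d L G => β₀ * wilsonAction ρ U))))
                (cycle (l₁.map (siteHeatBath (fun _ : Edge d L => haarProbability G)
                  (gibbsDensity fun U : GaugeConfig d L G => β₁ * wilsonAction ρ U))))).comap
                (fun hh : (j : ↥(Finset.Iic n)) → Bool × GaugeConfig d L G =>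
                  hh ⟨n, Finset.mem_Iic.2 le_rfl⟩) (measurable_pi_apply _))) -
          Real.sigmoid (c - ΔF)| ≤ 2 / (ε * n)) ∧
      (∀ n : ℕ, n ≠ 0 →
        Var[fun z : ℕ → Bool × GaugeConfig d L G => (∑ i ∈ range n,
            (targetLevel (GaugeConfig d L G)).indicator (1 : Bool × GaugeConfig d L G → ℝ) (z i)) / n;
          Kernel.trajMeasure (X := fun _ : ℕ => Bool × GaugeConfig d L G)
            ((jointWeight c (wilsonWeight (d := d) (L := L) ρ β₀)
              (wilsonWeight (d := d) (L := L) ρ β₁) univ)⁻¹ •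
              jointWeight c (wilsonWeight (d := d) (L := L) ρ β₀) (wilsonWeight (d := d) (L := L) ρ β₁))
            (fun n : ℕ => (switchKernel κF κR c W s e ∘ₖ levelKernel
              (cycle (l₀.map (siteHeatBath (fun _ : Edge d L => haarProbability G)
                (gibbsDensity fun U : GaugeConfig d L G => β₀ * wilsonAction ρ U))))
              (cycle (l₁.map (siteHeatBath (fun _ : Edge d L => haarProbability G)
                (gibbsDensity fun U : GaugeConfig d L G => β₁ * wilsonAction ρ U))))).comap
              (fun hh : (j : ↥(Finset.Iic n)) → Bool × GaugeConfig d L G =>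
                hh ⟨n, Finset.mem_Iic.2 le_rfl⟩) (measurable_pi_apply _))] ≤
          2 * (1 / 2 + (2 / ε - 1) / (1 - Real.sigmoid (c - ΔF))) *
            (Real.sigmoid (c - ΔF) * (1 - Real.sigmoid (c - ΔF))) / n) ∧
      (∀ n : ℕ, n ≠ 0 → ∀ η : ℝ, 0 < η →
        Kernel.trajMeasure (X := fun _ : ℕ => Bool × GaugeConfig d L G)
            ((jointWeight c (wilsonWeight (d := d) (L := L) ρ β₀)
              (wilsonWeight (d := d) (L := L) ρ β₁) univ)⁻¹ •
              jointWeight c (wilsonWeight (d := d) (L := L) ρ β₀) (wilsonWeight (d := d) (L := L) ρ β₁))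
            (fun n : ℕ => (switchKernel κF κR c W s e ∘ₖ levelKernel
              (cycle (l₀.map (siteHeatBath (fun _ : Edge d L => haarProbability G)
                (gibbsDensity fun U : GaugeConfig d L G => β₀ * wilsonAction ρ U))))
              (cycle (l₁.map (siteHeatBath (fun _ : Edge d L => haarProbability G)
                (gibbsDensity fun U : GaugeConfig d L G => β₁ * wilsonAction ρ U))))).comap
              (fun hh : (j : ↥(Finset.Iic n)) → Bool × GaugeConfig d L G =>
                hh ⟨n, Finset.mem_Iic.2 le_rfl⟩) (measurable_pi_apply _))
          {z | η ≤ |c - Real.log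
              ((∑ i ∈ range n, (targetLevel (GaugeConfig d L G)).indicator
                  (1 : Bool × GaugeConfig d L G → ℝ) (z i)) / n /
                (1 - (∑ i ∈ range n, (targetLevel (GaugeConfig d L G)).indicator
                  (1 : Bool × GaugeConfig d L G → ℝ) (z i)) / n)) - ΔF|} ≤
          ENNReal.ofReal (2 * (1 / 2 + (2 / ε - 1) / (1 - Real.sigmoid (c - ΔF))) *
            (Real.sigmoid (c - ΔF) * (1 - Real.sigmoid (c - ΔF))) / n /
            (min (Real.sigmoid (c - ΔF + η) - Real.sigmoid (c - ΔF))
              (Real.sigmoid (c - ΔF) - Real.sigmoid (c - ΔF - η))) ^ 2)) := by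
  obtain ⟨hMk₀, hfin₀, -, -, h0, -, hK₀, -⟩ := wilson_heatBathSweep_package ρ hρ β₀ hl₀
  obtain ⟨hMk₁, hfin₁, -, -, h1, -, hK₁, -⟩ := wilson_heatBathSweep_package ρ hρ β₁ hl₁
  obtain ⟨m₀, hmfin₀, hm₀, hmin₀, hac₀⟩ := wilson_heatBath_minorising ρ hρ β₀ hl₀
  obtain ⟨m₁, hmfin₁, hm₁, hmin₁, hac₁⟩ := wilson_heatBath_minorising ρ hρ β₁ hl₁
  haveI := hMk₀
  haveI := hMk₁
  haveI := hfin₀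
  haveI := hfin₁
  haveI := hmfin₀
  haveI := hmfin₁
  obtain ⟨ε, hε0, hε1, hA, hB, hC⟩ := h.ncmc_errorBars_of_exists_sq h0 h1 hK₀ hK₁
    (h.ncmc_exists_sq_doeblin hm₀ hm₁ hmin₀ hmin₁ hac₀ hac₁ c hW) hΔF
  exact ⟨isMarkovKernel_switchKernel (κF := κF) (κR := κR) (c := c)
      h.measurable_W h.measurable_s h.measurable_e, isMarkovKernel_levelKernel _ _, hfin₀, hfin₁,
    ε, hε0, hε1, hA, hB, hC⟩

end Wilson

end Summit.Ventures.LatticeQCDFlow.Exactness.GeneralNCMC
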